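import Mathlib
import Summits.Ventures.PercRepro.TriangleCapBroomDefs

/-!
# PercRepro — THE EQUALITY CASE OF THE NON-STAR BOUND: a triangle-free graph with `r ≥ 3` edges that is not a star
and attains `Σ_v d(v)² + 2 (r − 2) = r (r + 1)` is a BROOM (a star of `r − 1` edges with one edge hung at a leaf)
or, at `r = 4`, a `4`-CYCLE; hence the second-best `a`-bipartite graphs of every cell with `r ≥ 3` are `K_{a,k−a}`
minus a broom (or minus a `4`-cycle at `r = 4`), and on the row `a = 3` these are the second-best graphs
(p3, gen 45; part 204b)

Part 186's bound `Σ d² + 2 (r − 2) ≤ r (r + 1)` (`sum_deg_sq_le_of_not_star`) comes from a vertex `v₀` of maximum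
degree `Δ` with `s = r − Δ ≥ 1` edges off it: `Σ_{(v,w)} nonIncident = 2 r (r + 1) − 2 Σ d²` over the ordered
adjacent pairs, every off-pair avoids `≥ Δ − 1` of the `v₀`-edges, and the `v₀`-pairs avoid `≥ s (Δ − 1)` off-edges
together; `s (Δ − 1) − (r − 2) = (s − 1)(Δ − 2)`. AT EQUALITY every off-edge `x y` has `d(x) + d(y) = s + 2`
(`deg_add_deg_add_nonIncident`) and `(s − 1)(Δ − 2) = 0`: `s = 1` is the broom (the off-edge has an end of degree
`2`, whose other edge is at `v₀`, and an end of degree `1`); `Δ = 2` forces `s = 2`, `r = 4`, every off-edge end of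
degree `2`, and the two off-edges share a vertex and meet the two neighbours of `v₀` — the `4`-cycle.
`bipSub_second_best_locus`: an `a`-bipartite graph on the cell `(k, a, r)`, `r ≥ 3`, at `closed − 2 (r − 2)` has a
missing graph that is a broom or (`r = 4`) a `4`-cycle; `three_row_second_best_locus_broom`: on the row `a = 3`,
`k ≥ r + 7`, `r ≥ 3`, EVERY second-best graph is of that shape. Axioms: standard.
-/

namespace PercRepro

namespace TriangleCap

namespace C047

open Finset

variable {V : Type*} [Fintype V] [DecidableEq V]

set_option maxHeartbeats 400000 in
/-- **THE EQUALITY CASE OF THE NON-STAR BOUND:** a triangle-free graph with `r ≥ 3` edges, no vertex on all of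
them, and `Σ_v d(v)² + 2 (r − 2) = r (r + 1)` is a broom or (`r = 4`) a `4`-cycle. -/
theorem broom_or_c4_of_eq (H : SimpleGraph V) [DecidableRel H.Adj] (hfree : H.CliqueFree 3)
    (hr : 3 ≤ H.edgeFinset.card) (hns : ∀ v, ∃ e ∈ H.edgeFinset, v ∉ e)
    (heq : ∑ v, deg H v * deg H v + 2 * (H.edgeFinset.card - 2) = H.edgeFinset.card * (H.edgeFinset.card + 1)) :
    IsBroom H ∨ (H.edgeFinset.card = 4 ∧ IsC4 H) := by
  have hsum := sum_adjPairsAll_nonIncident_eq H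
  rw [sum_adjPairsAll_deg_add] at hsum
  -- a vertex of maximum degree
  have hne : (univ : Finset V).Nonempty := by
    obtain ⟨e, he⟩ := card_pos.mp (by omega : 0 < H.edgeFinset.card)
    revert he
    refine Sym2.ind (fun x y _ => ⟨x, mem_univ x⟩) e
  obtain ⟨v₀, -, hmax⟩ := exists_max_image univ (fun v => deg H v) hne
  have hoff : (H.edgeFinset.filter (fun e => v₀ ∉ e)).card + deg H v₀ = H.edgeFinset.card := by
    have := card_filter_add_card_filter_not (s := H.edgeFinset) (fun e => v₀ ∉ e)
    have h2 : H.edgeFinset.filter (fun e => ¬ v₀ ∉ e) = H.incidenceFinset v₀ := by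
      ext e
      simp only [mem_filter, SimpleGraph.mem_incidenceFinset, SimpleGraph.mem_edgeFinset, not_not]
      rfl
    rw [h2, ← deg_eq_card_incidenceFinset] at this
    exact this
  have hs : 1 ≤ (H.edgeFinset.filter (fun e => v₀ ∉ e)).card := by
    obtain ⟨e, he, hv⟩ := hns v₀
    exact card_pos.mpr ⟨e, mem_filter.mpr ⟨he, hv⟩⟩
  -- `Δ ≥ 2`: otherwise `Σ d² = 2r` and `2r + 2 (r − 2) = r (r + 1)` has no solution `r ≥ 3`
  have hΔ : 2 ≤ deg H v₀ := by
    by_contra hΔ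
    push Not at hΔ
    have hall : ∀ v, deg H v * deg H v = deg H v := by
      intro v
      have := hmax v (mem_univ v)
      have : deg H v ≤ 1 := by omega
      interval_cases h : deg H v <;> simp
    have h3 := sum_deg_eq H
    rw [sum_congr rfl (fun v _ => hall v), h3] at heq
    obtain ⟨m', hm'⟩ : ∃ m', H.edgeFinset.card = m' + 3 := ⟨H.edgeFinset.card - 3, by omega⟩
    rw [hm'] at heq
    have e : m' + 3 - 2 = m' + 1 := by omega
    rw [e] at heq
    nlinarith [heq]
  -- the split of the ordered adjacent pairs
  have hsplit := sum_filter_add_sum_filter_not (adjPairsAll H) (fun p : V × V => p.1 ≠ v₀ ∧ p.2 ≠ v₀)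
    (fun p => nonIncident H p.1 p.2)
  have hP1 : ∀ p ∈ (adjPairsAll H).filter (fun p : V × V => p.1 ≠ v₀ ∧ p.2 ≠ v₀),
      deg H v₀ - 1 ≤ nonIncident H p.1 p.2 := by
    intro p hp
    rw [mem_filter, mem_adjPairsAll] at hp
    have := nonIncident_ge_of_off H hfree v₀ hp.1 hp.2.1 hp.2.2
    omega
  have hP1' : ((adjPairsAll H).filter (fun p : V × V => p.1 ≠ v₀ ∧ p.2 ≠ v₀)).card * (deg H v₀ - 1) ≤
      ∑ p ∈ (adjPairsAll H).filter (fun p : V × V => p.1 ≠ v₀ ∧ p.2 ≠ v₀), nonIncident H p.1 p.2 := by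
    rw [← smul_eq_mul, ← sum_const]
    exact sum_le_sum hP1
  have hP2 := sum_nonIncident_at_eq H v₀
  have hP2' := sum_nonIncident_at_ge H hfree v₀
  have hcard := card_adjPairs_off_vertex H v₀
  set s := (H.edgeFinset.filter (fun e => v₀ ∉ e)).card with hs'
  set Δ := deg H v₀ with hΔ'
  clear_value s Δ
  -- the total `Σ nonIncident = 4 (r − 2)`, the two halves each `≥ 2 s (Δ − 1)`, and `s (Δ − 1) ≥ r − 2`
  have hcard2 : ((adjPairsAll H).filter (fun p : V × V => p.1 ≠ v₀ ∧ p.2 ≠ v₀)).card = 2 * s := by omega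
  rw [hcard2, mul_assoc] at hP1'
  obtain ⟨r, hr'⟩ : ∃ r, H.edgeFinset.card = r := ⟨_, rfl⟩
  obtain ⟨P, hP⟩ : ∃ P, s * (Δ - 1) = P := ⟨_, rfl⟩
  obtain ⟨X, hX⟩ : ∃ X, r * (r + 1) = X := ⟨_, rfl⟩
  obtain ⟨SOff, hSOff⟩ : ∃ SOff, ∑ p ∈ (adjPairsAll H).filter (fun p : V × V => p.1 ≠ v₀ ∧ p.2 ≠ v₀),
      nonIncident H p.1 p.2 = SOff := ⟨_, rfl⟩
  obtain ⟨SAt, hSAt⟩ : ∃ SAt, ∑ p ∈ (adjPairsAll H).filter (fun p : V × V => ¬ (p.1 ≠ v₀ ∧ p.2 ≠ v₀)),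
      nonIncident H p.1 p.2 = SAt := ⟨_, rfl⟩
  obtain ⟨A, hA⟩ : ∃ A, ∑ v, deg H v * deg H v = A := ⟨_, rfl⟩
  have key : r - 2 ≤ P := by
    rw [← hP, ← hr']
    obtain ⟨d, hd⟩ : ∃ d, Δ = d + 2 := ⟨Δ - 2, by omega⟩
    obtain ⟨t, ht⟩ : ∃ t, s = t + 1 := ⟨s - 1, by omega⟩
    have : H.edgeFinset.card = t + d + 3 := by omega
    rw [this, hd, ht]
    have e1 : t + d + 3 - 2 = t + d + 1 := by omega
    have e2 : d + 2 - 1 = d + 1 := by omega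
    rw [e1, e2]
    nlinarith [Nat.zero_le (t * d)]
  rw [← hsplit, hr', mul_assoc, hX, hA, hSOff, hSAt] at hsum
  rw [hr', hX, hA] at heq
  rw [hP, hSOff] at hP1'
  have h2 : 2 * P ≤ SAt := by rw [← hSAt, hP2, ← hP]; linarith [hP2']
  -- equality everywhere: `s (Δ − 1) = r − 2`, the off-pairs exactly `Δ − 1` each
  have hs1 : P = r - 2 := by omega
  have hoffeq : SOff = 2 * P := by omega
  have hoffeach : ∀ p ∈ (adjPairsAll H).filter (fun p : V × V => p.1 ≠ v₀ ∧ p.2 ≠ v₀),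
      nonIncident H p.1 p.2 = Δ - 1 := by
    have h := (sum_eq_sum_iff_of_le hP1).mp (by rw [sum_const, smul_eq_mul, hcard2, hSOff, hoffeq, ← hP]; ring)
    intro p hp
    exact (h p hp).symm
  rw [← hP, ← hr'] at hs1
  -- `(s − 1)(Δ − 2) = 0`
  have hcases : s = 1 ∨ Δ = 2 := by
    by_contra hcon
    push Not at hcon
    have h1 : 2 ≤ s := by omega
    have h2 : 3 ≤ Δ := by omega
    obtain ⟨d, hd⟩ : ∃ d, Δ = d + 3 := ⟨Δ - 3, by omega⟩
    obtain ⟨t, ht⟩ : ∃ t, s = t + 2 := ⟨s - 2, by omega⟩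
    have : H.edgeFinset.card = t + d + 5 := by omega
    rw [this, hd, ht] at hs1
    have e1 : t + d + 5 - 2 = t + d + 3 := by omega
    have e2 : d + 3 - 1 = d + 2 := by omega
    rw [e1, e2] at hs1
    nlinarith [hs1, Nat.zero_le (t * d)]
  -- every off-edge `x y` has `d(x) + d(y) = s + 2`
  have hoffdeg : ∀ x y, H.Adj x y → x ≠ v₀ → y ≠ v₀ → deg H x + deg H y = s + 2 := by
    intro x y hxy hx hy
    have h1 := hoffeach (x, y) (by rw [mem_filter, mem_adjPairsAll]; exact ⟨hxy, hx, hy⟩)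
    have h2 := deg_add_deg_add_nonIncident H hxy
    simp only at h1
    omega
  by_cases hs1' : s = 1
  · -- `s = 1`: the broom
    left
    have hs1'' : (H.edgeFinset.filter (fun e => v₀ ∉ e)).card = 1 := by rw [← hs']; exact hs1'
    obtain ⟨e, he⟩ := card_eq_one.mp hs1''
    have hemem : e ∈ H.edgeFinset ∧ v₀ ∉ e := by
      have : e ∈ H.edgeFinset.filter (fun e => v₀ ∉ e) := by rw [he]; exact mem_singleton_self e
      rw [mem_filter] at this
      exact this
    have hall : ∀ e' ∈ H.edgeFinset, v₀ ∈ e' ∨ e' = e := by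
      intro e' he'
      by_cases h : v₀ ∈ e'
      · exact Or.inl h
      · right
        have : e' ∈ H.edgeFinset.filter (fun e => v₀ ∉ e) := mem_filter.mpr ⟨he', h⟩
        rw [he, mem_singleton] at this
        exact this
    revert hemem hall
    refine Sym2.ind (fun x y hemem hall => ?_) e
    have hxy : H.Adj x y := by
      have := hemem.1
      rwa [SimpleGraph.mem_edgeFinset, SimpleGraph.mem_edgeSet] at this
    have hx : x ≠ v₀ := fun h => hemem.2 (by rw [← h]; exact Sym2.mem_mk_left x y)
    have hy : y ≠ v₀ := fun h => hemem.2 (by rw [← h]; exact Sym2.mem_mk_right x y)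
    have hdeg := hoffdeg x y hxy hx hy
    rw [hs1'] at hdeg
    -- one end has degree `2`, the other `1`
    have hx1 : 1 ≤ deg H x := by
      unfold deg; exact card_pos.mpr ⟨y, mem_filter.mpr ⟨mem_univ y, hxy⟩⟩
    have hy1 : 1 ≤ deg H y := by
      unfold deg; exact card_pos.mpr ⟨x, mem_filter.mpr ⟨mem_univ x, hxy.symm⟩⟩
    -- the end of degree `2` is adjacent to `v₀`, the end of degree `1` is not
    have hstep : ∀ a b, H.Adj a b → a ≠ v₀ → b ≠ v₀ → deg H a = 2 → deg H b = 1 →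
        (∀ e' ∈ H.edgeFinset, v₀ ∈ e' ∨ e' = s(a, b)) → IsBroom H := by
      intro a b hab ha hb hda hdb hall'
      obtain ⟨e₂, he₂, hae₂, hne⟩ := exists_other_edge H hda ((SimpleGraph.mem_edgeFinset).mpr hab)
        (Sym2.mem_mk_left a b)
      have hv₀ : v₀ ∈ e₂ := by
        rcases hall' e₂ he₂ with h | h
        · exact h
        · exact absurd h hne
      obtain ⟨w, hw, haw⟩ := edge_of_mem H he₂ hae₂
      have hwv : w = v₀ := by
        rw [hw, Sym2.mem_iff] at hv₀
        rcases hv₀ with h | h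
        · exact absurd h.symm ha
        · exact h.symm
      subst hwv
      refine ⟨w, a, b, haw.symm, hab, hb, ?_, hall'⟩
      intro hwb
      have := edge_unique_of_deg_one H hdb ((SimpleGraph.mem_edgeFinset).mpr hab) (Sym2.mem_mk_right a b)
        ((SimpleGraph.mem_edgeFinset).mpr hwb) (Sym2.mem_mk_right w b)
      rcases Sym2.eq_iff.mp this with ⟨h, -⟩ | ⟨h, -⟩
      · exact ha h
      · exact hab.ne h
    rcases Nat.lt_or_ge (deg H x) 2 with hx2 | hx2
    · have hdx : deg H x = 1 := by omega
      have hdy : deg H y = 2 := by omega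
      have hall' : ∀ e' ∈ H.edgeFinset, v₀ ∈ e' ∨ e' = s(y, x) := by
        intro e' he'
        rcases hall e' he' with h | h
        · exact Or.inl h
        · right; rw [h]; exact Sym2.eq_swap
      exact hstep y x hxy.symm hy hx hdy hdx hall'
    · have hdx : deg H x = 2 := by omega
      have hdy : deg H y = 1 := by omega
      exact hstep x y hxy hx hy hdx hdy hall
  · -- `Δ = 2`, `s ≥ 2`: `s = 2`, `r = 4`, the `4`-cycle
    right
    have hΔ2 : Δ = 2 := by rcases hcases with h | h; exact absurd h hs1'; exact h
    have hs2 : 2 ≤ s := by omega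
    have hdegle : ∀ v, deg H v ≤ 2 := fun v => by have := hmax v (mem_univ v); omega
    -- every off-edge has both ends of degree `2`, and `s = 2`
    have hoff2 : ∀ x y, H.Adj x y → x ≠ v₀ → y ≠ v₀ → deg H x = 2 ∧ deg H y = 2 ∧ s = 2 := by
      intro x y hxy hx hy
      have h := hoffdeg x y hxy hx hy
      have h1 := hdegle x
      have h2 := hdegle y
      omega
    -- the off-edges `f₁ ≠ f₂`
    obtain ⟨f₁, f₂, hf12, hF⟩ := card_eq_two.mp (show (H.edgeFinset.filter (fun e => v₀ ∉ e)).card = 2 by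
      rw [← hs']
      obtain ⟨e, he⟩ := card_pos.mp (by omega : 0 < (H.edgeFinset.filter (fun e => v₀ ∉ e)).card)
      have he' := mem_filter.mp he
      revert he'
      refine Sym2.ind (fun x y he' => ?_) e
      have hxy : H.Adj x y := by
        have := he'.1
        rwa [SimpleGraph.mem_edgeFinset, SimpleGraph.mem_edgeSet] at this
      exact (hoff2 x y hxy (fun h => he'.2 (by rw [← h]; exact Sym2.mem_mk_left x y))
        (fun h => he'.2 (by rw [← h]; exact Sym2.mem_mk_right x y))).2.2)
    have hmemF : ∀ e, e ∈ H.edgeFinset ∧ v₀ ∉ e ↔ e = f₁ ∨ e = f₂ := by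
      intro e
      have : e ∈ H.edgeFinset.filter (fun e => v₀ ∉ e) ↔ e = f₁ ∨ e = f₂ := by
        rw [hF, mem_insert, mem_singleton]
      rw [← this, mem_filter]
    have hf₁ := (hmemF f₁).mpr (Or.inl rfl)
    have hf₂ := (hmemF f₂).mpr (Or.inr rfl)
    -- the other edge of an end `a` (degree `2`, `a ≠ v₀`) of an off-edge `e₀`: `s(v₀, a)` or the other off-edge
    have hother : ∀ a, deg H a = 2 → a ≠ v₀ → ∀ e₀, a ∈ e₀ → e₀ ∈ H.edgeFinset →
        H.Adj v₀ a ∨ ∃ e₂, (e₂ = f₁ ∨ e₂ = f₂) ∧ e₂ ≠ e₀ ∧ a ∈ e₂ := by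
      intro a hda ha e₀ hae₀ he₀
      obtain ⟨e₂, he₂, hae₂, hne⟩ := exists_other_edge H hda he₀ hae₀
      by_cases hv : v₀ ∈ e₂
      · left
        obtain ⟨w, hw, haw⟩ := edge_of_mem H he₂ hae₂
        rw [hw, Sym2.mem_iff] at hv
        rcases hv with h | h
        · exact absurd h.symm ha
        · rw [h]; exact haw.symm
      · exact Or.inr ⟨e₂, (hmemF e₂).mp ⟨he₂, hv⟩, hne, hae₂⟩
    -- the structure from an off-edge `s(a, b)` with `a ∼ v₀`, `b ≁ v₀`
    have hbuild : ∀ a b, H.Adj a b → a ≠ v₀ → b ≠ v₀ → H.Adj v₀ a → ¬ H.Adj v₀ b → IsC4 H := by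
      intro a b hab ha hb hva hvb
      have hab' : s(a, b) = f₁ ∨ s(a, b) = f₂ := (hmemF _).mp ⟨(SimpleGraph.mem_edgeFinset).mpr hab,
        by rw [Sym2.mem_iff]; push Not; exact ⟨ha.symm, hb.symm⟩⟩
      have hdb : deg H b = 2 := (hoff2 a b hab ha hb).2.1
      rcases hother b hdb hb s(a, b) (Sym2.mem_mk_right a b) ((SimpleGraph.mem_edgeFinset).mpr hab) with h | ⟨e₂, he₂F, hne, hbe₂⟩
      · exact absurd h hvb
      have he₂ : e₂ ∈ H.edgeFinset ∧ v₀ ∉ e₂ := (hmemF e₂).mpr he₂F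
      obtain ⟨b', hb'e, hbb'⟩ := edge_of_mem H he₂.1 hbe₂
      have hb'v : b' ≠ v₀ := fun h => he₂.2 (by rw [hb'e, ← h]; exact Sym2.mem_mk_right b b')
      have hb'a : b' ≠ a := by
        intro h
        apply hne
        rw [hb'e, h]
        exact Sym2.eq_swap
      have hdb' : deg H b' = 2 := (hoff2 b b' hbb' hb hb'v).2.1
      -- `b′`'s other edge is at `v₀`
      have hvb' : H.Adj v₀ b' := by
        rcases hother b' hdb' hb'v e₂ (by rw [hb'e]; exact Sym2.mem_mk_right b b') he₂.1 with h | ⟨e₃, he₃F, hne₃, hb'e₃⟩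
        · exact h
        · exfalso
          -- `e₃ ≠ e₂` are both off-edges, so `{e₃, e₂} = {f₁, f₂}` and `s(a, b)` is one of them: `s(a, b) = e₃`
          have hsab : s(a, b) = e₃ := by
            rcases hab' with h1 | h1 <;> rcases he₂F with h2 | h2 <;> rcases he₃F with h3 | h3
            all_goals first
              | exact h1.trans h3.symm
              | exact absurd (h2.trans h3.symm) hne₃.symm
              | exact absurd (h1.trans h2.symm) hne.symm
          rw [← hsab, Sym2.mem_iff] at hb'e₃
          rcases hb'e₃ with h | h
          · exact hb'a h
          · exact hbb'.ne h.symm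
      -- `N(v₀) = {a, b′}`
      have hN : univ.filter (fun u => H.Adj v₀ u) = {a, b'} := by
        symm
        apply eq_of_subset_of_card_le
        · intro w hw
          simp only [mem_insert, mem_singleton] at hw
          rw [mem_filter]
          rcases hw with rfl | rfl
          · exact ⟨mem_univ _, hva⟩
          · exact ⟨mem_univ _, hvb'⟩
        · have : (univ.filter (fun u => H.Adj v₀ u)).card = Δ := by rw [hΔ']; rfl
          rw [this, hΔ2, card_pair hb'a.symm]
      refine ⟨v₀, a, b', b, hva, hvb', hab, hbb'.symm, hb'a.symm, hb.symm, ?_⟩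
      intro e he
      by_cases hv : v₀ ∈ e
      · obtain ⟨w, hw, hvw⟩ := edge_of_mem H he hv
        have hwN : w ∈ univ.filter (fun u => H.Adj v₀ u) := mem_filter.mpr ⟨mem_univ w, hvw⟩
        rw [hN, mem_insert, mem_singleton] at hwN
        rcases hwN with rfl | rfl
        · exact Or.inl hw
        · exact Or.inr (Or.inl hw)
      · have heF := (hmemF e).mp ⟨he, hv⟩
        -- `e ∈ {f₁, f₂} = {s(a, b), e₂}`
        have : e = s(a, b) ∨ e = e₂ := by
          rcases hab' with h1 | h1 <;> rcases he₂F with h2 | h2 <;> rcases heF with h3 | h3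
          all_goals first
            | exact Or.inl (h3.trans h1.symm)
            | exact Or.inr (h3.trans h2.symm)
            | exact absurd (h1.trans h2.symm) hne.symm
        rcases this with h | h
        · exact Or.inr (Or.inr (Or.inl h))
        · right; right; right
          rw [h, hb'e]
          exact Sym2.eq_swap
    -- the two ends of `f₁ = s(x, y)`: one is a neighbour of `v₀`, the other is not
    revert hf₁
    refine Sym2.ind (fun x y hf₁ => ?_) f₁
    have hxy : H.Adj x y := by
      have := hf₁.1
      rwa [SimpleGraph.mem_edgeFinset, SimpleGraph.mem_edgeSet] at this
    have hx : x ≠ v₀ := fun h => hf₁.2 (by rw [← h]; exact Sym2.mem_mk_left x y)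
    have hy : y ≠ v₀ := fun h => hf₁.2 (by rw [← h]; exact Sym2.mem_mk_right x y)
    have hr4 : H.edgeFinset.card = 4 := by
      have := (hoff2 x y hxy hx hy).2.2
      omega
    refine ⟨hr4, ?_⟩
    by_cases hvx : H.Adj v₀ x
    · by_cases hvy : H.Adj v₀ y
      · exact absurd (SimpleGraph.is3Clique_triple_iff.mpr ⟨hvx, hvy, hxy⟩) (hfree {v₀, x, y})
      · exact hbuild x y hxy hx hy hvx hvy
    · by_cases hvy : H.Adj v₀ y
      · exact hbuild y x hxy.symm hy hx hvy hvx
      · exfalso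
        -- both ends off `N(v₀)`: their other edges are both the other off-edge, which is then `s(x, y)` itself
        have hdx : deg H x = 2 := (hoff2 x y hxy hx hy).1
        have hdy : deg H y = 2 := (hoff2 x y hxy hx hy).2.1
        rcases hother x hdx hx s(x, y) (Sym2.mem_mk_left x y) hf₁.1 with h | ⟨e₂, he₂F, hne, hxe₂⟩
        · exact hvx h
        rcases hother y hdy hy s(x, y) (Sym2.mem_mk_right x y) hf₁.1 with h | ⟨e₃, he₃F, hne₃, hye₃⟩
        · exact hvy h
        -- `e₂ = e₃ = f₂` (the only off-edge other than `s(x, y) = f₁`)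
        have hsxy : s(x, y) = f₁ ∨ s(x, y) = f₂ := (hmemF _).mp hf₁
        have h23 : e₂ = e₃ := by
          rcases hsxy with h1 | h1 <;> rcases he₂F with h2 | h2 <;> rcases he₃F with h3 | h3
          all_goals first
            | exact h2.trans h3.symm
            | exact absurd (h1.trans h2.symm) hne.symm
            | exact absurd (h1.trans h3.symm) hne₃.symm
        rw [← h23] at hye₃
        -- `e₂` contains `x` and `y`: `e₂ = s(x, y)`
        obtain ⟨w, hw, hxw⟩ := edge_of_mem H ((hmemF e₂).mpr he₂F).1 hxe₂
        rw [hw, Sym2.mem_iff] at hye₃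
        rcases hye₃ with h | h
        · exact hxy.ne h.symm
        · exact hne (by rw [hw, h])

end C047

end TriangleCap

end PercRepro
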